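import Summits.AtomisticToContinuum.FouriersLaw.Theorems.HonestZwanzigRobinCoercivityStubBlockFormAux

/-!
# `HonestZwanzig.RobinCoercivity` — corner coercivity from the crux, part 1: linear algebra

Support file (`--supports` the crux `RobinCoercivity`, stmt-AtomisticToContinuum-12695, of route `HonestZwanzig`,
sub-problem `FouriersLaw`; auxiliary to the LINK lemma `cornerCoercivity_of_robinCoercivity` of line
`limit-operator-memory-form`, skeleton `Cruxes/RobinCoercivity/Lines/limit_operator_memory_form.lean`, proved in
`…CornerOfCrux`). No dynamics here: pure linear algebra on `Fin M` / `Fin (N+1)`.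

* `corner_bound_abstract` (registered sub-goal): for a symmetric matrix `W` on `Fin M`, a `±1` vector `u` with flux-row
  bound `|(Wu)_i| ≤ C` and coercivity `yᵀWy ≥ (c/2)|y|²` on `u^⊥`, every vector `v` with at most `w` nonzero entries has
  `vᵀWv ≥ (c/4)|v|²` as soon as `Mc ≥ 2wc + 20Cw` — split `v = y + αu` (`α = ⟨v,u⟩/M`, `y ⊥ u`), expand
  (`corner_quad_decomp`), and use `(Σ|v_i|)² ≤ w|v|²` (`corner_l1_sq_le`) to make the flux terms `≤ 5Cw|v|²/M`.
* `corner_partialSum_Bv`: `u^⊥ ⊆ Ran B` for the Robin incidence `B` of the block form (`blockForm_Bv_zero/succ/succ_last`,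
  `…StubBlockFormAux`): `y ⊥ u = (1,…,1,−1)` is `Bξ` for the partial sums `ξ_x = Σ_{i ≤ x} y_i`, with
  `|ξ|² ≤ N(N+1)|y|²`.
* `corner_threshold` (the large-`N` threshold) and `corner_quad_le` (`ξᵀMξ ≤ (Σ|M_{xy}|)|ξ|²`).
-/

noncomputable section

open Finset

namespace Summit.AtomisticToContinuum.FouriersLaw.Theorems.HonestZwanzig.Robin

/-! ### Pure linear algebra on `Fin M` -/

/-- Cauchy–Schwarz on a support: if `v` vanishes off `S` then `(Σ_i |v_i|)² ≤ #S · Σ_i v_i²`. -/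
theorem corner_l1_sq_le {M : ℕ} (v : Fin M → ℝ) (S : Finset (Fin M)) (hv : ∀ i, i ∉ S → v i = 0) :
    (∑ i, |v i|) ^ 2 ≤ (S.card : ℝ) * ∑ i, v i ^ 2 := by
  classical
  have h1 : ∑ i, |v i| = ∑ i, |v i| * (if i ∈ S then (1 : ℝ) else 0) := by
    refine Finset.sum_congr rfl fun i _ => ?_
    by_cases hi : i ∈ S
    · rw [if_pos hi, mul_one]
    · rw [if_neg hi, mul_zero, hv i hi, abs_zero]
  have h2 : ∑ i : Fin M, (if i ∈ S then (1 : ℝ) else 0) ^ 2 = S.card := by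
    have h : ∀ i : Fin M, (if i ∈ S then (1 : ℝ) else 0) ^ 2 = if i ∈ S then (1 : ℝ) else 0 := fun i => by
      split_ifs <;> norm_num
    simp only [h, Finset.sum_boole, Finset.filter_mem_eq_inter, Finset.univ_inter]
  have h3 : ∑ i : Fin M, |v i| ^ 2 = ∑ i, v i ^ 2 := by simp only [sq_abs]
  rw [h1]
  calc (∑ i, |v i| * (if i ∈ S then (1 : ℝ) else 0)) ^ 2
      ≤ (∑ i, |v i| ^ 2) * ∑ i : Fin M, (if i ∈ S then (1 : ℝ) else 0) ^ 2 :=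
        Finset.sum_mul_sq_le_sq_mul_sq _ _ _
    _ = (S.card : ℝ) * ∑ i, v i ^ 2 := by rw [h2, h3, mul_comm]

/-- Expansion of a quadratic form of a symmetric matrix along `v = y + αu`:
`vᵀWv = yᵀWy + 2α·Σ_i y_i (Wu)_i + α²·Σ_i u_i (Wu)_i`. -/
theorem corner_quad_decomp {M : ℕ} (W : Fin M → Fin M → ℝ) (hsym : ∀ i j, W i j = W j i)
    (u y v : Fin M → ℝ) (α : ℝ) (hv : ∀ i, v i = y i + α * u i) :
    ∑ i, ∑ j, v i * W i j * v j = ∑ i, ∑ j, y i * W i j * y j +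
      2 * α * ∑ i, y i * (∑ j, W i j * u j) + α ^ 2 * ∑ i, u i * (∑ j, W i j * u j) := by
  have hx : ∀ i j, v i * W i j * v j = y i * W i j * y j + α * (y i * (W i j * u j)) +
      α * (u i * W i j * y j) + α ^ 2 * (u i * (W i j * u j)) := fun i j => by
    rw [hv i, hv j]
    ring
  have hcross : ∑ i, ∑ j, u i * W i j * y j = ∑ i, ∑ j, y i * (W i j * u j) := by
    rw [Finset.sum_comm]
    refine Finset.sum_congr rfl fun i _ => Finset.sum_congr rfl fun j _ => ?_
    rw [hsym j i]
    ring
  have hsplit : ∑ i, ∑ j, v i * W i j * v j = ∑ i, ∑ j, y i * W i j * y j +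
      α * ∑ i, ∑ j, y i * (W i j * u j) + α * ∑ i, ∑ j, u i * W i j * y j +
      α ^ 2 * ∑ i, ∑ j, u i * (W i j * u j) := by
    simp only [hx, Finset.sum_add_distrib, Finset.mul_sum]
  have hf1 : ∑ i, y i * (∑ j, W i j * u j) = ∑ i, ∑ j, y i * (W i j * u j) := by
    simp only [Finset.mul_sum]
  have hf2 : ∑ i, u i * (∑ j, W i j * u j) = ∑ i, ∑ j, u i * (W i j * u j) := by
    simp only [Finset.mul_sum]
  rw [hsplit, hcross, hf1, hf2]
  ring

/-- **Corner coercivity, abstract form.** Let `W` be a symmetric `M × M` matrix, `u` a `±1` vector, with flux-row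
bound `|(Wu)_i| ≤ C` and coercivity `yᵀWy ≥ (c/2)|y|²` on `u^⊥`. If `Mc ≥ 2wc + 20Cw` then `vᵀWv ≥ (c/4)|v|²` for every
`v` with at most `w` nonzero entries (supported in a set `S` with `#S ≤ w`). -/
theorem corner_bound_abstract {M : ℕ} (hM : 0 < M) (W : Fin M → Fin M → ℝ) (hsym : ∀ i j, W i j = W j i)
    (u : Fin M → ℝ) (hu : ∀ j, u j = 1 ∨ u j = -1) (c C : ℝ) (hc : 0 < c) (w : ℕ)
    (hfl : ∀ i, |∑ j, W i j * u j| ≤ C)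
    (hcoer : ∀ y : Fin M → ℝ, ∑ j, y j * u j = 0 → c / 2 * ∑ j, y j ^ 2 ≤ ∑ i, ∑ j, y i * W i j * y j)
    (hMw : 2 * (w : ℝ) * c + 20 * C * w ≤ (M : ℝ) * c)
    (v : Fin M → ℝ) (S : Finset (Fin M)) (hS : S.card ≤ w) (hv : ∀ i, i ∉ S → v i = 0) :
    c / 4 * ∑ i, v i ^ 2 ≤ ∑ i, ∑ j, v i * W i j * v j := by
  have hMr : (0 : ℝ) < M := by exact_mod_cast hM
  have hC : 0 ≤ C := le_trans (abs_nonneg _) (hfl ⟨0, hM⟩)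
  have hu1 : ∀ j, |u j| = 1 := fun j => by rcases hu j with h | h <;> simp [h]
  have hu2 : ∀ j, u j ^ 2 = 1 := fun j => by rcases hu j with h | h <;> simp [h]
  -- the scalars of the decomposition
  obtain ⟨V, hV⟩ : ∃ V : ℝ, V = ∑ i, v i ^ 2 := ⟨_, rfl⟩
  obtain ⟨A, hA⟩ : ∃ A : ℝ, A = ∑ i, |v i| := ⟨_, rfl⟩
  obtain ⟨Sv, hSv⟩ : ∃ Sv : ℝ, Sv = ∑ j, v j * u j := ⟨_, rfl⟩
  obtain ⟨α, hα⟩ : ∃ α : ℝ, α = Sv / M := ⟨_, rfl⟩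
  obtain ⟨y, hy⟩ : ∃ y : Fin M → ℝ, ∀ i, y i = v i - α * u i := ⟨_, fun _ => rfl⟩
  have hV0 : 0 ≤ V := hV ▸ Finset.sum_nonneg fun i _ => sq_nonneg _
  have hA0 : 0 ≤ A := hA ▸ Finset.sum_nonneg fun i _ => abs_nonneg _
  -- `|⟨v,u⟩| ≤ Σ|v_i|` and the sparse bound `(Σ|v_i|)² ≤ w|v|²`
  have hSA : |Sv| ≤ A := by
    rw [hSv, hA]
    refine (Finset.abs_sum_le_sum_abs _ _).trans (Finset.sum_le_sum fun j _ => ?_)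
    rw [abs_mul, hu1, mul_one]
  have hAV : A ^ 2 ≤ (w : ℝ) * V := by
    rw [hA, hV]
    refine (corner_l1_sq_le v S hv).trans ?_
    exact mul_le_mul_of_nonneg_right (by exact_mod_cast hS) (Finset.sum_nonneg fun i _ => sq_nonneg _)
  -- `y ⊥ u`
  have hαM : α * M = Sv := by
    rw [hα]
    field_simp
  have hyu : ∑ j, y j * u j = 0 := by
    have h1 : ∀ j, y j * u j = v j * u j - α * u j ^ 2 := fun j => by
      rw [hy]
      ring
    simp only [h1, Finset.sum_sub_distrib, hu2, Finset.sum_const, Finset.card_univ, Fintype.card_fin,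
      nsmul_eq_mul, mul_one]
    rw [← hSv]
    linarith
  -- the decomposition `v = y + αu`
  have hvy : ∀ i, v i = y i + α * u i := fun i => by
    rw [hy]
    ring
  have hdec := corner_quad_decomp W hsym u y v α hvy
  -- bounds on the flux terms
  have hT1 : |∑ i, y i * ∑ j, W i j * u j| ≤ C * ∑ i, |y i| := by
    refine (Finset.abs_sum_le_sum_abs _ _).trans ?_
    rw [Finset.mul_sum]
    refine Finset.sum_le_sum fun i _ => ?_
    rw [abs_mul, mul_comm C]
    exact mul_le_mul_of_nonneg_left (hfl i) (abs_nonneg _)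
  have hT2 : |∑ i, u i * ∑ j, W i j * u j| ≤ M * C := by
    refine (Finset.abs_sum_le_sum_abs _ _).trans ?_
    calc ∑ i, |u i * ∑ j, W i j * u j| ≤ ∑ _i : Fin M, C := Finset.sum_le_sum fun i _ => by
            rw [abs_mul, hu1, one_mul]
            exact hfl i
      _ = M * C := by rw [Finset.sum_const, Finset.card_univ, Fintype.card_fin, nsmul_eq_mul]
  -- `Σ|y_i| ≤ 2 Σ|v_i|` and `|α| ≤ Σ|v_i| / M`
  have hMα : (M : ℝ) * |α| = |Sv| := by
    rw [hα, abs_div, abs_of_pos hMr]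
    field_simp
  have hyA : ∑ i, |y i| ≤ 2 * A := by
    have h1 : ∀ i, |y i| ≤ |v i| + |α| := fun i => by
      rw [hy]
      calc |v i - α * u i| ≤ |v i| + |α * u i| := abs_sub _ _
        _ = |v i| + |α| := by rw [abs_mul, hu1, mul_one]
    have h2 : ∑ i, |y i| ≤ ∑ i, (|v i| + |α|) := Finset.sum_le_sum fun i _ => h1 i
    rw [Finset.sum_add_distrib, Finset.sum_const, Finset.card_univ, Fintype.card_fin, nsmul_eq_mul, ← hA,
      hMα] at h2
    linarith
  have hαA : |α| ≤ A / M := by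
    rw [le_div_iff₀ hMr, mul_comm, hMα]
    exact hSA
  -- `|y|² = |v|² − ⟨v,u⟩²/M ≥ |v|² − (Σ|v_i|)²/M`
  have hyy : ∑ i, y i ^ 2 = V - Sv ^ 2 / M := by
    have h1 : ∀ i, y i ^ 2 = v i ^ 2 - 2 * α * (v i * u i) + α ^ 2 * u i ^ 2 := fun i => by
      rw [hy]
      ring
    simp only [h1, Finset.sum_add_distrib, Finset.sum_sub_distrib, ← Finset.mul_sum, hu2, Finset.sum_const,
      Finset.card_univ, Fintype.card_fin, nsmul_eq_mul, mul_one, ← hV, ← hSv]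
    rw [hα]
    field_simp
    ring
  have hSv2 : Sv ^ 2 ≤ A ^ 2 := by
    rw [← sq_abs Sv]
    exact pow_le_pow_left₀ (abs_nonneg _) hSA 2
  have hyV : V - A ^ 2 / M ≤ ∑ i, y i ^ 2 := by
    rw [hyy]
    have := div_le_div_of_nonneg_right hSv2 hMr.le
    linarith
  -- coercivity on `u^⊥`
  have hcy := hcoer y hyu
  -- the two flux terms are `O(C (Σ|v_i|)² / M)`
  have hb1 : |2 * α * ∑ i, y i * ∑ j, W i j * u j| ≤ 4 * (C * (A ^ 2 / M)) := by
    rw [abs_mul, abs_mul, abs_two]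
    have h1 : |∑ i, y i * ∑ j, W i j * u j| ≤ C * (2 * A) :=
      hT1.trans (mul_le_mul_of_nonneg_left hyA hC)
    calc 2 * |α| * |∑ i, y i * ∑ j, W i j * u j| ≤ 2 * (A / M) * (C * (2 * A)) :=
          mul_le_mul (mul_le_mul_of_nonneg_left hαA zero_le_two) h1 (abs_nonneg _) (by positivity)
      _ = 4 * (C * (A ^ 2 / M)) := by ring
  have hb2 : |α ^ 2 * ∑ i, u i * ∑ j, W i j * u j| ≤ C * (A ^ 2 / M) := by
    rw [abs_mul, abs_pow, sq_abs]
    have hα2 : α ^ 2 ≤ (A / M) ^ 2 := by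
      rw [← sq_abs α]
      exact pow_le_pow_left₀ (abs_nonneg _) hαA 2
    calc α ^ 2 * |∑ i, u i * ∑ j, W i j * u j| ≤ (A / M) ^ 2 * (M * C) :=
          mul_le_mul hα2 hT2 (abs_nonneg _) (by positivity)
      _ = C * (A ^ 2 / M) := by
          field_simp
  -- the threshold
  have hthr : (c / 2 + 5 * C) * (A ^ 2 / M) ≤ c / 4 * V := by
    have h1 : (c / 2 + 5 * C) * (A ^ 2 / M) ≤ (c / 2 + 5 * C) * ((w : ℝ) * V / M) :=
      mul_le_mul_of_nonneg_left (div_le_div_of_nonneg_right hAV hMr.le) (by positivity)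
    have h2 : (c / 2 + 5 * C) * ((w : ℝ) * V / M) = ((2 * (w : ℝ) * c + 20 * C * w) / 4) * (V / M) := by ring
    have h3 : ((2 * (w : ℝ) * c + 20 * C * w) / 4) * (V / M) ≤ ((M : ℝ) * c / 4) * (V / M) :=
      mul_le_mul_of_nonneg_right (by linarith) (by positivity)
    have h4 : ((M : ℝ) * c / 4) * (V / M) = c / 4 * V := by
      field_simp
    linarith
  -- assemble
  rw [← hV, hdec]
  have e1 := neg_abs_le (2 * α * ∑ i, y i * ∑ j, W i j * u j)
  have e2 := neg_abs_le (α ^ 2 * ∑ i, u i * ∑ j, W i j * u j)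
  nlinarith [e1, e2, hb1, hb2, hthr, hcy, hyV, hc, hC, hV0]

/-- The large-`N` threshold: for `N ≥ N₁(c, C, w)` one has `2wc + 20Cw ≤ (N+1)c`. -/
theorem corner_threshold (c C : ℝ) (w : ℕ) (hc : 0 < c) :
    ∃ N₁ : ℕ, ∀ N : ℕ, N₁ ≤ N → 2 * (w : ℝ) * c + 20 * C * w ≤ ((N : ℝ) + 1) * c := by
  obtain ⟨N₁, hN₁⟩ := exists_nat_ge ((2 * (w : ℝ) * c + 20 * C * w) / c)
  refine ⟨N₁, fun N hN => ?_⟩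
  have h1 : (N₁ : ℝ) ≤ N := by exact_mod_cast hN
  calc 2 * (w : ℝ) * c + 20 * C * w = (2 * (w : ℝ) * c + 20 * C * w) / c * c := (div_mul_cancel₀ _ hc.ne').symm
    _ ≤ (N₁ : ℝ) * c := mul_le_mul_of_nonneg_right hN₁ hc.le
    _ ≤ ((N : ℝ) + 1) * c := mul_le_mul_of_nonneg_right (by linarith) hc.le

/-- A crude bound on a quadratic form: `ξᵀMξ ≤ (Σ_{x,y} |M_{xy}|)·|ξ|²`. -/
theorem corner_quad_le {n : ℕ} (Mx : Fin n → Fin n → ℝ) (ξ : Fin n → ℝ) :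
    ∑ x, ∑ y, ξ x * Mx x y * ξ y ≤ (∑ x, ∑ y, |Mx x y|) * ∑ x, ξ x ^ 2 := by
  have hsq : ∀ x, ξ x ^ 2 ≤ ∑ z, ξ z ^ 2 := fun x =>
    Finset.single_le_sum (fun z _ => sq_nonneg (ξ z)) (Finset.mem_univ x)
  rw [Finset.sum_mul]
  refine Finset.sum_le_sum fun x _ => ?_
  rw [Finset.sum_mul]
  refine Finset.sum_le_sum fun y _ => ?_
  calc ξ x * Mx x y * ξ y ≤ |ξ x * Mx x y * ξ y| := le_abs_self _
    _ = |Mx x y| * (|ξ x| * |ξ y|) := by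
        rw [abs_mul, abs_mul]
        ring
    _ ≤ |Mx x y| * ∑ z, ξ z ^ 2 := mul_le_mul_of_nonneg_left ?_ (abs_nonneg _)
  nlinarith [hsq x, hsq y, sq_abs (ξ x), sq_abs (ξ y), abs_nonneg (ξ x), abs_nonneg (ξ y),
    sq_nonneg (|ξ x| - |ξ y|)]

/-! ### `Ran B = u^⊥`: partial sums -/

/-- **`u^⊥ ⊆ Ran B`.** For `y : Fin (N+1) → ℝ` with `Σ_{j<N} y_j − y_N = 0`, the partial-sum profile
`ξ_x = Σ_{i ≤ x} y_i` satisfies `Bξ = y`, and `|ξ|² ≤ N(N+1)|y|²`. -/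
theorem corner_partialSum_Bv {N : ℕ} (hN : 1 ≤ N) (Bv : (Fin N → ℝ) → Fin (N + 1) → ℝ)
    (hBv : ∀ ξ i, Bv ξ i = if i.val = N then (∑ x : Fin N, if x.val + 1 = N then ξ x else 0)
      else ∑ x : Fin N, ((if x.val = i.val then ξ x else 0) - (if x.val + 1 = i.val then ξ x else 0)))
    (y : Fin (N + 1) → ℝ) (hy : ∑ j : Fin (N + 1), y j * (if j.val = N then -1 else 1) = 0) :
    ∃ ξ : Fin N → ℝ, (∀ i, Bv ξ i = y i) ∧ ∑ x, ξ x ^ 2 ≤ ((N : ℝ) * ((N : ℝ) + 1)) * ∑ i, y i ^ 2 := by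
  refine ⟨fun x => ∑ i : Fin (N + 1), if i.val ≤ x.val then y i else 0, ?_, ?_⟩
  · intro i
    rcases Fin.eq_zero_or_eq_succ i with rfl | ⟨b, rfl⟩
    · rw [blockForm_Bv_zero Bv hBv hN]
      refine sum_ite_eq_of_unique y 0 (by simp) (fun j hj => Fin.ext ?_)
      rw [Fin.val_zero]
      exact Nat.le_zero.mp hj
    · by_cases hb : b.val + 1 < N
      · rw [blockForm_Bv_succ Bv hBv _ b hb, ← Finset.sum_sub_distrib]
        have h1 : ∀ j : Fin (N + 1), ((if j.val ≤ (⟨b.val + 1, hb⟩ : Fin N).val then y j else 0) -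
            (if j.val ≤ b.val then y j else 0)) = if j.val = b.val + 1 then y j else 0 := by
          intro j
          show ((if j.val ≤ b.val + 1 then y j else 0) - (if j.val ≤ b.val then y j else 0)) = _
          by_cases h : j.val = b.val + 1
          · rw [if_pos h, if_pos h.le, if_neg (by omega), sub_zero]
          · by_cases h' : j.val ≤ b.val
            · rw [if_neg h, if_pos (by omega), if_pos h', sub_self]
            · rw [if_neg h, if_neg (by omega), if_neg h', sub_zero]
        simp only [h1]
        exact sum_ite_eq_of_unique y b.succ (Fin.val_succ b) (fun j hj => Fin.ext (by rw [Fin.val_succ]; exact hj))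
      · have hb' : b.val + 1 = N := by omega
        rw [blockForm_Bv_succ_last Bv hBv _ b hb']
        have h1 : ∑ j : Fin (N + 1), y j * (if j.val = N then -1 else 1) =
            (∑ j : Fin (N + 1), if j.val ≤ b.val then y j else 0) -
              ∑ j : Fin (N + 1), if j.val = N then y j else 0 := by
          rw [← Finset.sum_sub_distrib]
          refine Finset.sum_congr rfl fun j _ => ?_
          have hj := j.isLt
          by_cases hjN : j.val = N
          · rw [if_pos hjN, if_neg (by omega), if_pos hjN]
            ring
          · rw [if_neg hjN, if_pos (by omega), if_neg hjN]
            ring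
        have h2 : (∑ j : Fin (N + 1), if j.val = N then y j else 0) = y b.succ :=
          sum_ite_eq_of_unique y b.succ (by rw [Fin.val_succ]; exact hb')
            (fun j hj => Fin.ext (by rw [Fin.val_succ]; omega))
        rw [h1, h2] at hy
        show (∑ j : Fin (N + 1), if j.val ≤ b.val then y j else 0) = y b.succ
        linarith
  · have hV0 : 0 ≤ ∑ i, y i ^ 2 := Finset.sum_nonneg fun i _ => sq_nonneg _
    have h1 : ∀ x : Fin N, (∑ i : Fin (N + 1), if i.val ≤ x.val then y i else 0) ^ 2 ≤
        ((N : ℝ) + 1) * ∑ i, y i ^ 2 := by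
      intro x
      have h2 : (∑ i : Fin (N + 1), if i.val ≤ x.val then y i else 0) =
          ∑ i : Fin (N + 1), y i * (if i.val ≤ x.val then 1 else 0) := by
        refine Finset.sum_congr rfl fun i _ => ?_
        split_ifs <;> ring
      have h3 : ∑ i : Fin (N + 1), (if i.val ≤ x.val then (1 : ℝ) else 0) ^ 2 ≤ (N : ℝ) + 1 := by
        calc ∑ i : Fin (N + 1), (if i.val ≤ x.val then (1 : ℝ) else 0) ^ 2 ≤ ∑ _i : Fin (N + 1), (1 : ℝ) :=
              Finset.sum_le_sum fun i _ => by split_ifs <;> norm_num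
          _ = (N : ℝ) + 1 := by
              rw [Finset.sum_const, Finset.card_univ, Fintype.card_fin, nsmul_eq_mul, mul_one]
              push_cast
              ring
      rw [h2]
      calc (∑ i : Fin (N + 1), y i * (if i.val ≤ x.val then 1 else 0)) ^ 2
          ≤ (∑ i, y i ^ 2) * ∑ i : Fin (N + 1), (if i.val ≤ x.val then (1 : ℝ) else 0) ^ 2 :=
            Finset.sum_mul_sq_le_sq_mul_sq _ _ _
        _ ≤ (∑ i, y i ^ 2) * ((N : ℝ) + 1) := mul_le_mul_of_nonneg_left h3 hV0
        _ = ((N : ℝ) + 1) * ∑ i, y i ^ 2 := mul_comm _ _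
    calc ∑ x : Fin N, (∑ i : Fin (N + 1), if i.val ≤ x.val then y i else 0) ^ 2
        ≤ ∑ _x : Fin N, ((N : ℝ) + 1) * ∑ i, y i ^ 2 := Finset.sum_le_sum fun x _ => h1 x
      _ = ((N : ℝ) * ((N : ℝ) + 1)) * ∑ i, y i ^ 2 := by
          rw [Finset.sum_const, Finset.card_univ, Fintype.card_fin, nsmul_eq_mul]
          ring

end Summit.AtomisticToContinuum.FouriersLaw.Theorems.HonestZwanzig.Robin

end
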